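import Summits.QuantumFields.YangMills.Theorems.IR.EsPolymerEngineK

/-!
# Crux `IR` (item stmt-QuantumFields-19354; re-typed leaf `IRcof`, item stmt-QuantumFields-26930) — line
«es-polymer-decoupling»: the reshaped ENGINE ON A SET OF COUPLINGS and the composition to `IRcof`

Helper module for item `stmt-QuantumFields-19354` (`--supports … --as helper`; it closes nothing; lead prover
ym-ir-line-mxc-p1 g5).  The infrared leaf of `route-QuantumFields-BalabanLadder` was RE-TYPED (R423/R424, route rev 12) to
its COFINAL form `Summit.QuantumFields.YangMills.Theses.BalabanLadder.IRcof` (the `GapInUnits` family owed only on SOME set of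
couplings unbounded above); director-ym №25 (2) asks every line to re-price itself.  This file is the kernel-checked part of the
re-pricing of the es-polymer line (vocabulary `Theorems/IR/EsPolymerDefsK.lean`):

* `gapOn_of_DPRkOn` — THE RESHAPED ENGINE ON A COUPLING SET: with the absolute Peierls parameter `p₀ = (4 (13⁴+1)²)⁻²` of
  the landed `EngineK.polymerEngineK`, a `DPRk` (disjoint-polymer representation with clauses (I)_k (D)_k at every block
  radius) at a physical mesh `⌈ℓ/a(β)⌉` for the couplings `β ∈ Bset`, `β ≥ β₂`, and all tori `S ≥ S₁ β` gives the
  `GapInUnits` family ON `Bset` (the body of `IRcof`'s conclusion, written out; no new definition).  The proof is the landed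
  engine's, per coupling (its constants see `β` only through `a(β) ≤ 1` and the mesh bound `a(β) ⌈ℓ/a(β)⌉ ≤ ℓ + 1`):
  grid-cell bookkeeping `GridCells.*`, two-region gas mixing `GasMixing.abs_blockCov_le_pow`, trivial bound at short range.
  `Bset = univ` is `PolymerEngineK`.
* `ircof_of_polymerCertKCof` — composition concluding the re-typed route decl BY NAME from the COFINAL polymer load
  (`LowerBounds ⇒ ∀ p > 0, ∃ Bset` unbounded above with `DPRk` at a physical mesh on `Bset`), and
  `polymerCertKCof_of_irPolymerCertK` (the load of record `IRPolymerCertK` implies it, `Bset = univ`).  The cofinal load is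
  the ONLY `sorry` of the cofinal skeleton `Cruxes/IR/Lines/es_polymer_decoupling_cofinal.lean`.

RE-PRICING VERDICT: WALL UNCHANGED — the load is the weak-coupling polymer representation AT a large coupling (all large tori);
the quantifier over couplings was never the difficulty; class EQUIV-or-stronger, simplicity load-bearing, unchanged.
HONEST FRAMING: generic probability/combinatorics re-threaded per coupling; no weak-coupling result, no lattice mass gap, no part
of the Clay Yang–Mills problem is proved; CONDITIONAL rung line; R4 closes only the finite-𝕋⁴ UV rung `BalabanLadder.UV`.
-/

set_option autoImplicit false

noncomputable section

open Filter Topology MeasureTheory Finset Function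
open Literature.MathematicalPhysics.QuantumFieldTheory
open Literature.MathematicalPhysics.QuantumLattice (LGConfig torusEdge torusLift configShift IsCylinder
  integral_comp_configShift_torusLift)
open Summit.QuantumFields.YangMills.Cruxes.OSLegsFromFemtoAndGap.DlrCollarTransfer (GapInUnits LowerBounds)
open Summit.QuantumFields.YangMills.Cruxes.IR.EsPolymer.GridCells
open Summit.QuantumFields.YangMills.Cruxes.IR.EsPolymer.GasMixing (abs_blockCov_le_pow)
open Summit.QuantumFields.YangMills.Cruxes.IR.EsPolymer.EngineK (abs_integral_le_of_abs_le measurable_torusLift')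

namespace Summit.QuantumFields.YangMills.Cruxes.IR.EsPolymer.EngineK

-- heartbeat budget of the landed engine `polymerEngineK` (one long `calc` chain per regime over the torus Wilson state)
set_option maxHeartbeats 400000 in
/-- **The reshaped engine ON A COUPLING SET** (Peierls parameter `p₀ = (4 (13⁴+1)²)⁻²`).  For every compact group `G`
(Borel σ-algebra or any `BorelSpace` structure), representation `r`, positive unit `a → 0`, ANY set of couplings `Bset`, and
a physical mesh `ℓ > 0`: if `DPRk r.ρ β S ⌈ℓ / a β⌉₊ p₀` holds for the couplings `β ∈ Bset`, `β ≥ β₂`, on all tori `S ≥ S₁ β`,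
then the `GapInUnits` family of clustering bounds holds ON `Bset` — rate `c₁ = log(2(13⁴+1)²)/(12(ℓ+1))`, one constant per
pair of species, thresholds `max β₂ βa` (`a ≤ 1` beyond `βa`) and `S₁`.  Per-coupling re-threading of `polymerEngineK`
(same heartbeat budget as the landed engine: one long `calc` chain per regime over the torus Wilson state). -/
theorem gapOn_of_DPRkOn :
    ∀ (G : Type) [Group G] [TopologicalSpace G] [IsTopologicalGroup G] [CompactSpace G]
      [MeasurableSpace G] [BorelSpace G] (r : LatticeRep G) (a : ℝ → ℝ), (∀ β, 0 < a β) → Tendsto a atTop (𝓝 0) →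
      ∀ (Bset : Set ℝ) (ℓ β₂ : ℝ) (S₁ : ℝ → ℕ), 0 < ℓ →
        (∀ β ∈ Bset, β₂ ≤ β → ∀ S : ℕ, S₁ β ≤ S →
          DPRk r.ρ β S ⌈ℓ / a β⌉₊ (((4 * (((13 : ℝ) ^ 4 + 1) ^ 2))⁻¹) ^ 2)) →
        ∃ (c₁ β₂' : ℝ) (S₁' : ℝ → ℕ), 0 < c₁ ∧ ∀ A B : YMSpecies G, ∃ C : ℝ, ∀ β ∈ Bset, β₂' ≤ β →
          ∀ S n : ℕ, S₁' β ≤ S → n ≤ S →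
            |latticeConnectedCorr r.ρ β (2 * S + 1) A.F B.F n| ≤ C * Real.exp (-(c₁ * a β * n)) := by
  set M : ℝ := (13 : ℝ) ^ 4 + 1 with hM
  have hM1 : 1 < M := by rw [hM]; norm_num
  have hM0 : 0 < M := by linarith
  intro G _ _ _ _ _ _ r a ha ha0 Bset ℓ β₂ S₁ hℓ hD
  -- eventually `a β ≤ 1`
  obtain ⟨βa, hβa⟩ : ∃ βa : ℝ, ∀ β, βa ≤ β → a β ≤ 1 := by
    obtain ⟨βa, h⟩ := Filter.mem_atTop_sets.1 (ha0 (Iic_mem_nhds zero_lt_one))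
    exact ⟨βa, fun β hβ => h β hβ⟩
  -- constants
  set Lθ : ℝ := Real.log (2 * M ^ 2) with hLθ
  have h2M : 1 < 2 * M ^ 2 := by nlinarith
  have hLθ0 : 0 < Lθ := Real.log_pos h2M
  have hθexp : Real.exp (-Lθ) = (2 * M ^ 2)⁻¹ := by
    rw [hLθ, ← Real.log_inv]; exact Real.exp_log (by positivity)
  set c₁ : ℝ := Lθ / (12 * (ℓ + 1)) with hc₁
  have hc₁0 : 0 < c₁ := by positivity
  refine ⟨c₁, max β₂ βa, S₁, hc₁0, ?_⟩
  intro A B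
  obtain ⟨CA, hCA⟩ := A.bounded
  obtain ⟨CB, hCB⟩ := B.bounded
  have hCA0 : 0 ≤ CA := (abs_nonneg _).trans (hCA fun _ => 1)
  have hCB0 : 0 ≤ CB := (abs_nonneg _).trans (hCB fun _ => 1)
  set k : ℕ := max (suppRadius A.supp) (suppRadius B.supp) with hk
  set C₁ : ℝ := 8 * CA * CB * ((2 * k + 3 : ℕ) : ℝ) ^ 4 * Real.exp (k * Lθ / 3) with hC₁
  set C₂ : ℝ := 2 * CA * CB * Real.exp (c₁ * (2 * (ℓ + 1) * (2 * k + 2))) with hC₂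
  have hC₁0 : 0 ≤ C₁ := by positivity
  have hC₂0 : 0 ≤ C₂ := by positivity
  refine ⟨C₁ + C₂, ?_⟩
  intro β hβB hβ S n hS hn
  have hβ2 : β₂ ≤ β := le_of_max_le_left hβ
  have haβ1 : a β ≤ 1 := hβa β (le_of_max_le_right hβ)
  have haβ : 0 < a β := ha β
  obtain ⟨q, w, hg, act, Z, ν, hZ, hact, hν0, hsum, hmass, hI, hDk⟩ := hD β hβB hβ2 S hS
  haveI : NeZero q := ⟨(hg.1).ne'⟩
  haveI : Nonempty G := ⟨1⟩
  -- the mesh `b = ⌈ℓ / a β⌉₊ ≥ 1` and `a β · b ≤ ℓ + 1`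
  set b : ℕ := ⌈ℓ / a β⌉₊ with hb
  have hb1 : 1 ≤ b := Nat.one_le_iff_ne_zero.2 (Nat.ceil_pos.2 (div_pos hℓ haβ)).ne'
  have hbℓ : a β * b ≤ ℓ + 1 := by
    have h1 : (b : ℝ) < ℓ / a β + 1 := Nat.ceil_lt_add_one (by positivity)
    calc a β * b ≤ a β * (ℓ / a β + 1) := mul_le_mul_of_nonneg_left h1.le haβ.le
      _ = ℓ + a β := by field_simp
      _ ≤ ℓ + 1 := by linarith
  -- the torus Wilson state and the two observables
  haveI : IsProbabilityMeasure (wilsonMeasure (d := 4) (L := 2 * S + 1) r.ρ β) :=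
    isProbabilityMeasure_wilsonMeasure (d := 4) (L := 2 * S + 1) r.ρ r.continuous β
  set A' : GaugeConfig 4 (2 * S + 1) G → ℝ := fun U => A.F (torusLift (2 * S + 1) U) with hA'
  set B' : GaugeConfig 4 (2 * S + 1) G → ℝ :=
    fun U => B.F (configShift (-Pi.single 0 (n : ℤ)) (torusLift (2 * S + 1) U)) with hB'
  have hAm : Measurable A' := A.measurable.comp (measurable_torusLift' (2 * S + 1))
  have hBm : Measurable B' :=
    B.measurable.comp ((configShift _).measurable.comp (measurable_torusLift' (2 * S + 1)))
  have hA : ∀ U, |A' U| ≤ CA := fun U => hCA _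
  have hB : ∀ U, |B' U| ≤ CB := fun U => hCB _
  -- cells of the two supports
  set cA : Cell q := cellOf q w 0 with hcA
  set cB : Cell q := cellOf q w (Pi.single 0 (n : ℤ)) with hcB
  have hdepA : DependsOn A' (blockEdges (2 * S + 1) q w cA k) :=
    dependsOn_blockEdges hg hb1 A.isCylinder (le_max_left _ _)
  have hdepB : DependsOn B' (blockEdges (2 * S + 1) q w cB k) :=
    dependsOn_blockEdges_shift hg hb1 B.isCylinder (le_max_right _ _) _
  have hlow : (n : ℤ) + 1 ≤ 2 * (b : ℤ) * (cellDist cA cB + 1) := succ_le_mul_cellDist hg hb1 hn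
  have hlowR : (n : ℝ) + 1 ≤ 2 * (b : ℝ) * ((cellDist cA cB : ℝ) + 1) := by exact_mod_cast hlow
  -- the connected correlation is the covariance of `A'`, `B'` (translation invariance for the mean of `B`)
  have hmeanB := (integral_comp_configShift_torusLift (S := 2 * S + 1) r.ρ β B.F (-Pi.single 0 (n : ℤ))).symm
  have hcorr : latticeConnectedCorr r.ρ β (2 * S + 1) A.F B.F n =
      (∫ U, A' U * B' U ∂(wilsonMeasure (d := 4) (L := 2 * S + 1) r.ρ β)) -
        (∫ U, A' U ∂(wilsonMeasure (d := 4) (L := 2 * S + 1) r.ρ β)) *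
          (∫ U, B' U ∂(wilsonMeasure (d := 4) (L := 2 * S + 1) r.ρ β)) := by
    unfold latticeConnectedCorr
    rw [hmeanB]
  rw [hcorr]
  have hexp0 : 0 < Real.exp (-(c₁ * a β * n)) := Real.exp_pos _
  by_cases hreg : 2 * k + 2 ≤ cellDist cA cB
  · /- ENGINE REGIME -/
    obtain ⟨ΦA, hΦA⟩ := hDk k cA A' hAm ⟨CA, hA⟩ hdepA
    obtain ⟨ΦB, hΦB⟩ := hDk k cB B' hBm ⟨CB, hB⟩ hdepB
    have hIk : ∀ Γ, Compatible Γ → Disjoint (nearFamily Γ cA k) (nearFamily Γ cB k) →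
        (ν Γ Set.univ).toReal * ∫ U, A' U * B' U ∂(ν Γ) = (∫ U, A' U ∂(ν Γ)) * (∫ U, B' U ∂(ν Γ)) :=
      fun Γ hΓ hdis => hI Γ hΓ k cA cB A' B' hAm hBm ⟨CA, hA⟩ ⟨CB, hB⟩ hdepA hdepB hreg hdis
    have hsq : Real.sqrt (((4 * M ^ 2)⁻¹) ^ 2) = (4 * M ^ 2)⁻¹ := Real.sqrt_sq (by positivity)
    have hsmall : ((13 : ℝ) ^ 4 + 1) ^ 2 * (2 * Real.sqrt (((4 * M ^ 2)⁻¹) ^ 2)) ≤ 1 / 2 := by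
      rw [hsq, ← hM]
      have : M ^ 2 * (2 * (4 * M ^ 2)⁻¹) = 1 / 2 := by field_simp; ring
      exact this.le
    have hbd := abs_blockCov_le_pow ν (wilsonMeasure (d := 4) (L := 2 * S + 1) r.ρ β) hsum hν0 hAm hBm hA hB k
      cA cB act (fun γ => (hact γ).1) hmass (by positivity) (fun γ => (hact γ).2) hsmall hIk ΦA ΦB hΦA hΦB
    have hθ : (2 * Real.sqrt (((4 * M ^ 2)⁻¹) ^ 2) : ℝ) = (2 * M ^ 2)⁻¹ := by rw [hsq]; field_simp; ring
    rw [hθ] at hbd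
    set d : ℕ := cellDist cA cB with hd
    set e : ℕ := (d - (2 * k + 2)) / 6 + 2 with he
    have he6 : (d : ℝ) + 1 ≤ 6 * (e : ℝ) + 2 * k := by
      have : d + 1 ≤ 6 * e + 2 * k := by omega
      exact_mod_cast this
    have hpow : ((2 * M ^ 2)⁻¹ : ℝ) ^ e = Real.exp (-(e * Lθ)) := by
      rw [← hθexp, ← Real.exp_nat_mul]; congr 1; ring
    -- the exponent bookkeeping `c₁ a(β) n ≤ e L + k L / 3`
    have key : c₁ * a β * n ≤ e * Lθ + k * Lθ / 3 := by
      have hn' : (n : ℝ) ≤ 2 * b * ((d : ℝ) + 1) := by linarith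
      calc c₁ * a β * n ≤ c₁ * a β * (2 * b * ((d : ℝ) + 1)) := by gcongr
        _ = Lθ / (12 * (ℓ + 1)) * (a β * b) * (2 * ((d : ℝ) + 1)) := by rw [hc₁]; ring
        _ ≤ Lθ / (12 * (ℓ + 1)) * (ℓ + 1) * (2 * ((d : ℝ) + 1)) := by gcongr
        _ = Lθ * ((d : ℝ) + 1) / 6 := by field_simp; ring
        _ ≤ Lθ * (6 * (e : ℝ) + 2 * k) / 6 := by gcongr
        _ = e * Lθ + k * Lθ / 3 := by ring
    have hexp : Real.exp (-(e * Lθ)) ≤ Real.exp (k * Lθ / 3) * Real.exp (-(c₁ * a β * n)) := by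
      rw [← Real.exp_add]; exact Real.exp_le_exp.2 (by linarith)
    calc |(∫ U, A' U * B' U ∂(wilsonMeasure (d := 4) (L := 2 * S + 1) r.ρ β)) -
            (∫ U, A' U ∂(wilsonMeasure (d := 4) (L := 2 * S + 1) r.ρ β)) *
              (∫ U, B' U ∂(wilsonMeasure (d := 4) (L := 2 * S + 1) r.ρ β))|
          ≤ 8 * CA * CB * ((2 * k + 3 : ℕ) : ℝ) ^ 4 * ((2 * M ^ 2)⁻¹) ^ e := hbd
      _ = 8 * CA * CB * ((2 * k + 3 : ℕ) : ℝ) ^ 4 * Real.exp (-(e * Lθ)) := by rw [hpow]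
      _ ≤ 8 * CA * CB * ((2 * k + 3 : ℕ) : ℝ) ^ 4 * (Real.exp (k * Lθ / 3) * Real.exp (-(c₁ * a β * n))) := by
          gcongr
      _ = C₁ * Real.exp (-(c₁ * a β * n)) := by rw [hC₁]; ring
      _ ≤ (C₁ + C₂) * Real.exp (-(c₁ * a β * n)) := by gcongr; linarith
  · /- SHORT REGIME: trivial bound -/
    have hd : cellDist cA cB ≤ 2 * k + 1 := by omega
    have hnb : (n : ℝ) ≤ 2 * b * (2 * (k : ℝ) + 2) := by
      have : ((cellDist cA cB : ℕ) : ℝ) + 1 ≤ 2 * (k : ℝ) + 2 := by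
        exact_mod_cast (by omega : cellDist cA cB + 1 ≤ 2 * k + 2)
      have h2b : (0 : ℝ) ≤ 2 * b := by positivity
      nlinarith
    have key : c₁ * a β * n ≤ c₁ * (2 * (ℓ + 1) * (2 * k + 2)) := by
      have h1 : a β * n ≤ (a β * b) * (2 * (2 * (k : ℝ) + 2)) := by nlinarith
      have h2 : (a β * b) * (2 * (2 * (k : ℝ) + 2)) ≤ (ℓ + 1) * (2 * (2 * (k : ℝ) + 2)) :=
        mul_le_mul_of_nonneg_right hbℓ (by positivity)
      have h3 : c₁ * a β * n = c₁ * (a β * n) := by ring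
      rw [h3]
      exact mul_le_mul_of_nonneg_left (by linarith) hc₁0.le
    have hone : (1 : ℝ) ≤ Real.exp (c₁ * (2 * (ℓ + 1) * (2 * k + 2))) * Real.exp (-(c₁ * a β * n)) := by
      rw [← Real.exp_add]; exact Real.one_le_exp (by linarith)
    have hi1 := abs_integral_le_of_abs_le (wilsonMeasure (d := 4) (L := 2 * S + 1) r.ρ β)
      (f := fun U => A' U * B' U) (C := CA * CB)
      (fun U => by rw [abs_mul]; exact mul_le_mul (hA U) (hB U) (abs_nonneg _) hCA0)
    have hi2 := abs_integral_le_of_abs_le (wilsonMeasure (d := 4) (L := 2 * S + 1) r.ρ β) (f := A') hA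
    have hi3 := abs_integral_le_of_abs_le (wilsonMeasure (d := 4) (L := 2 * S + 1) r.ρ β) (f := B') hB
    calc |(∫ U, A' U * B' U ∂(wilsonMeasure (d := 4) (L := 2 * S + 1) r.ρ β)) -
            (∫ U, A' U ∂(wilsonMeasure (d := 4) (L := 2 * S + 1) r.ρ β)) *
              (∫ U, B' U ∂(wilsonMeasure (d := 4) (L := 2 * S + 1) r.ρ β))|
          ≤ |∫ U, A' U * B' U ∂(wilsonMeasure (d := 4) (L := 2 * S + 1) r.ρ β)| +
            |∫ U, A' U ∂(wilsonMeasure (d := 4) (L := 2 * S + 1) r.ρ β)| *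
              |∫ U, B' U ∂(wilsonMeasure (d := 4) (L := 2 * S + 1) r.ρ β)| := by
          rw [← abs_mul]; exact abs_sub _ _
      _ ≤ CA * CB + CA * CB := by gcongr
      _ = 2 * CA * CB * 1 := by ring
      _ ≤ 2 * CA * CB * (Real.exp (c₁ * (2 * (ℓ + 1) * (2 * k + 2))) * Real.exp (-(c₁ * a β * n))) := by
          gcongr
      _ = C₂ * Real.exp (-(c₁ * a β * n)) := by rw [hC₂]; ring
      _ ≤ (C₁ + C₂) * Real.exp (-(c₁ * a β * n)) := by gcongr; linarith

/-- **COFINAL POLYMER LOAD ⇒ `IRcof`.**  The hypothesis is the cofinal re-cut of the line's load `IRPolymerCertK`: for compact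
SIMPLE `G`, non-triviality in units `a` (`LowerBounds`) gives, for EVERY Peierls parameter `p > 0`, a set of couplings `Bset`
UNBOUNDED ABOVE on which a `DPRk` at some physical mesh holds on all large tori (`Bset` may depend on `p`; the engine uses
`p₀` only).  With the engine on `Bset` this is the re-typed leaf, literally. -/
theorem ircof_of_polymerCertKCof
    (h : ∀ (G : Type) [Group G] [TopologicalSpace G] [IsTopologicalGroup G] [CompactSpace G],
      IsCompactSimpleLieGroup G → letI : MeasurableSpace G := borel G; haveI : BorelSpace G := ⟨rfl⟩;
      ∀ (r : LatticeRep G) (a : ℝ → ℝ), (∀ β, 0 < a β) → Tendsto a atTop (𝓝 0) → LowerBounds G r a →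
        ∀ p : ℝ, 0 < p → ∃ Bset : Set ℝ, (∀ x : ℝ, ∃ β ∈ Bset, x ≤ β) ∧
          ∃ (ℓ β₂ : ℝ) (S₁ : ℝ → ℕ), 0 < ℓ ∧
            ∀ β ∈ Bset, β₂ ≤ β → ∀ S : ℕ, S₁ β ≤ S → DPRk r.ρ β S ⌈ℓ / a β⌉₊ p) :
    Summit.QuantumFields.YangMills.Theses.BalabanLadder.IRcof := by
  delta Summit.QuantumFields.YangMills.Theses.BalabanLadder.IRcof
  intro G _ _ _ _ hG
  letI : MeasurableSpace G := borel G
  haveI : BorelSpace G := ⟨rfl⟩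
  intro r a ha ha0 hlb
  obtain ⟨Bset, hcof, ℓ, β₂, S₁, hℓ, hD⟩ :=
    h G hG r a ha ha0 hlb (((4 * (((13 : ℝ) ^ 4 + 1) ^ 2))⁻¹) ^ 2) (by positivity)
  exact ⟨Bset, hcof, gapOn_of_DPRkOn G r a ha ha0 Bset ℓ β₂ S₁ hℓ hD⟩

/-- **The load of record implies the cofinal load** (`Bset = univ`): the cofinal re-cut is WEAKER than `IRPolymerCertK`. -/
theorem polymerCertKCof_of_irPolymerCertK (hC : IRPolymerCertK) :
    ∀ (G : Type) [Group G] [TopologicalSpace G] [IsTopologicalGroup G] [CompactSpace G],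
      IsCompactSimpleLieGroup G → letI : MeasurableSpace G := borel G; haveI : BorelSpace G := ⟨rfl⟩;
      ∀ (r : LatticeRep G) (a : ℝ → ℝ), (∀ β, 0 < a β) → Tendsto a atTop (𝓝 0) → LowerBounds G r a →
        ∀ p : ℝ, 0 < p → ∃ Bset : Set ℝ, (∀ x : ℝ, ∃ β ∈ Bset, x ≤ β) ∧
          ∃ (ℓ β₂ : ℝ) (S₁ : ℝ → ℕ), 0 < ℓ ∧
            ∀ β ∈ Bset, β₂ ≤ β → ∀ S : ℕ, S₁ β ≤ S → DPRk r.ρ β S ⌈ℓ / a β⌉₊ p := by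
  intro G _ _ _ _ hG
  letI : MeasurableSpace G := borel G
  haveI : BorelSpace G := ⟨rfl⟩
  intro r a ha ha0 hlb p hp
  obtain ⟨ℓ, β₂, S₁, hℓ, hD⟩ := hC G hG r a ha ha0 hlb p hp
  exact ⟨Set.univ, fun x => ⟨x, Set.mem_univ _, le_rfl⟩, ℓ, β₂, S₁, hℓ, fun β _ hβ S hS => hD β hβ S hS⟩

/-- **`IR ⇒ IRcof` through this line's currency is consistent with the tree:** the load of record closes the re-typed leaf. -/
theorem ircof_of_irPolymerCertK (hC : IRPolymerCertK) : Summit.QuantumFields.YangMills.Theses.BalabanLadder.IRcof :=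
  ircof_of_polymerCertKCof (polymerCertKCof_of_irPolymerCertK hC)

end Summit.QuantumFields.YangMills.Cruxes.IR.EsPolymer.EngineK

end
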